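import Mathlib
import Summits.Ventures.PercRepro2.AS3Cases

/-!
# 2-sums of events and their packings: a piece of packing number ≤ 1 is used at most once
(seat mine-b, cell pub-perc-repro2; conjectures/MINE-B.md §13)

**2-sums of events.**  For an event `A₁` on the subsets of `E₁`, an element `p : E₁` and an event
`A₂` on the subsets of `E₂`, the **2-sum** `twoSum A₁ A₂ p` is the event on the subsets of `E₁ ⊕ E₂`
«`A₁` holds on the left part, where `p` counts as present exactly when `A₂` holds on the right part»
(`leftCfg`).  For clutters this is the 2-sum of clutters (series composition at `p`: every member
through `p` has `p` replaced by a member of `A₂`; the subdivision of an edge is the case of a path),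
and for ports of binary matroids it is the port of the matroid 2-sum `M₁ ⊕₂ M₂` at an element of `M₁`
(MINE-B.md §12.3, Seymour's decomposition route to the row (NOF7-STEP) ⊇ (REG-STEP)).

**Main lemma** (`kDisj_twoSum_iff`).  If `A₂` has packing number ≤ 1 (no two disjoint witnesses
anywhere — e.g. the port `Q₆` of `F₇*`, any clutter of pairwise intersecting members, a series path),
then `k` pairwise disjoint witnesses of the 2-sum inside `X` are exactly `k` pairwise disjoint witnesses
of `A₁` inside the left configuration of `X`: a packing of the 2-sum uses `p` at most once, because two
members through `p` would carry two disjoint witnesses of `A₂` in the right part.  The two directions are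
explicit couplings — the «lift» `(T ∪ K.toLeft).disjSum K.toRight` of a left configuration and the
«descent» of a left witness (its trace without `p`, plus the whole right part when it uses `p`).
The STEP closure theorem built on this is in TwoSumStep.lean.
-/

open Finset

namespace Summit.Ventures.PercRepro2

namespace StepZero

open ReimerCube

variable {E₁ E₂ : Type*} [DecidableEq E₁]

section Defs

open Classical in
/-- the left configuration of the 2-sum: the left part of `X` (without `p`), with `p` added exactly
when the right part carries `A₂` -/
noncomputable def leftCfg (A₂ : Finset E₂ → Prop) (p : E₁) (X : Finset (E₁ ⊕ E₂)) : Finset E₁ :=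
  X.toLeft.erase p ∪ (if A₂ X.toRight then {p} else ∅)

/-- the 2-sum of the events `A₁` (at the element `p : E₁`) and `A₂`, as an event on `Finset (E₁ ⊕ E₂)` -/
def twoSum (A₁ : Finset E₁ → Prop) (A₂ : Finset E₂ → Prop) (p : E₁) (X : Finset (E₁ ⊕ E₂)) : Prop :=
  A₁ (leftCfg A₂ p X)

end Defs

open Classical

/-- the left configuration is monotone in the configuration (for increasing `A₂`) -/
lemma leftCfg_mono {A₂ : Finset E₂ → Prop} (hA₂ : Incr A₂) (p : E₁) {S T : Finset (E₁ ⊕ E₂)}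
    (hST : S ⊆ T) : leftCfg A₂ p S ⊆ leftCfg A₂ p T := by
  unfold leftCfg
  apply Finset.union_subset_union
  · exact Finset.erase_subset_erase p (Finset.toLeft_subset_toLeft hST)
  · by_cases h : A₂ S.toRight
    · have h' : A₂ T.toRight := hA₂ (Finset.toRight_subset_toRight hST) h
      simp [h, h']
    · simp [h]

/-- the 2-sum of increasing events is increasing -/
lemma incr_twoSum {A₁ : Finset E₁ → Prop} {A₂ : Finset E₂ → Prop} (hA₁ : Incr A₁) (hA₂ : Incr A₂)
    (p : E₁) : Incr (twoSum A₁ A₂ p) :=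
  fun _ _ hST h => hA₁ (leftCfg_mono hA₂ p hST) h

/-- the left configuration of a disjoint sum -/
lemma leftCfg_disjSum (A₂ : Finset E₂ → Prop) (p : E₁) (T : Finset E₁) (R : Finset E₂) :
    leftCfg A₂ p (T.disjSum R) = T.erase p ∪ (if A₂ R then {p} else ∅) := by
  simp [leftCfg]

/-- `p` belongs to the left configuration only if the right part carries `A₂` -/
lemma A₂_of_mem_leftCfg {A₂ : Finset E₂ → Prop} {p : E₁} {X : Finset (E₁ ⊕ E₂)}
    (h : p ∈ leftCfg A₂ p X) : A₂ X.toRight := by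
  unfold leftCfg at h
  rw [Finset.mem_union] at h
  rcases h with h | h
  · exact absurd (Finset.mem_erase.mp h).1 (fun h' => h' rfl)
  · by_contra h2
    simp [h2] at h

/-- the left part of the left configuration: `x ≠ p` in `leftCfg` means `inl x ∈ X` -/
lemma mem_toLeft_of_mem_leftCfg {A₂ : Finset E₂ → Prop} {p : E₁} {X : Finset (E₁ ⊕ E₂)} {x : E₁}
    (hx : x ∈ leftCfg A₂ p X) (hxp : x ≠ p) : x ∈ X.toLeft := by
  unfold leftCfg at hx
  rw [Finset.mem_union] at hx
  rcases hx with hx | hx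
  · exact (Finset.mem_erase.mp hx).2
  · exfalso
    by_cases h2 : A₂ X.toRight
    · simp [h2] at hx; exact hxp hx
    · simp [h2] at hx

/-- the left configuration of the «lift» `(T ∪ K.toLeft).disjSum K.toRight` of `T ⊇ leftCfg K` lies
inside `T` -/
lemma leftCfg_lift_subset {A₂ : Finset E₂ → Prop} {p : E₁} {K : Finset (E₁ ⊕ E₂)} {T : Finset E₁}
    (hT : leftCfg A₂ p K ⊆ T) :
    leftCfg A₂ p ((T ∪ K.toLeft).disjSum K.toRight) ⊆ T := by
  rw [leftCfg_disjSum]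
  apply Finset.union_subset
  · intro x hx
    rw [Finset.mem_erase, Finset.mem_union] at hx
    rcases hx with ⟨hxp, hx | hx⟩
    · exact hx
    · exact hT (Finset.mem_union_left _ (Finset.mem_erase.mpr ⟨hxp, hx⟩))
  · by_cases h2 : A₂ K.toRight
    · simp only [h2, if_true]
      intro x hx
      rw [Finset.mem_singleton] at hx
      subst hx
      apply hT
      unfold leftCfg
      simp [h2]
    · simp [h2]

/-- the lift contains `K` -/
lemma subset_lift {K : Finset (E₁ ⊕ E₂)} (T : Finset E₁) :
    K ⊆ (T ∪ K.toLeft).disjSum K.toRight := by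
  rw [Finset.subset_disjSum]
  exact ⟨Finset.subset_union_right, le_rfl⟩

/-- the «descent» of a subset `K'` of the left configuration of `X`: the configuration of the 2-sum
that carries `K'` — the left part of `K'` together with the whole right part of `X` when `p ∈ K'` -/
noncomputable def descent (p : E₁) (X : Finset (E₁ ⊕ E₂)) (K' : Finset E₁) :
    Finset (E₁ ⊕ E₂) :=
  (K'.erase p).disjSum (if p ∈ K' then X.toRight else ∅)

/-- the descent of a subset of the left configuration of `X` lies inside `X` -/
lemma descent_subset {A₂ : Finset E₂ → Prop} {p : E₁} {X : Finset (E₁ ⊕ E₂)} {K' : Finset E₁}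
    (hK' : K' ⊆ leftCfg A₂ p X) : descent p X K' ⊆ X := by
  unfold descent
  rw [Finset.disjSum_subset]
  constructor
  · intro x hx
    rw [Finset.mem_erase] at hx
    exact mem_toLeft_of_mem_leftCfg (hK' hx.2) hx.1
  · by_cases hp : p ∈ K'
    · simp [hp]
    · simp [hp]

/-- anything containing the descent of `K'` has `K'` inside its left configuration -/
lemma subset_leftCfg_of_descent_subset {A₂ : Finset E₂ → Prop} (hA₂ : Incr A₂) {p : E₁}
    {X T : Finset (E₁ ⊕ E₂)} {K' : Finset E₁} (hK' : K' ⊆ leftCfg A₂ p X)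
    (hT : descent p X K' ⊆ T) : K' ⊆ leftCfg A₂ p T := by
  intro x hx
  unfold leftCfg
  by_cases hxp : x = p
  · subst hxp
    have h2 : A₂ X.toRight := A₂_of_mem_leftCfg (hK' hx)
    have hR : X.toRight ⊆ T.toRight := by
      intro y hy
      rw [Finset.mem_toRight]
      apply hT
      unfold descent
      rw [Finset.inr_mem_disjSum]
      simp [hx, hy]
    have h2' : A₂ T.toRight := hA₂ hR h2
    simp [h2']
  · apply Finset.mem_union_left
    rw [Finset.mem_erase]
    refine ⟨hxp, ?_⟩
    rw [Finset.mem_toLeft]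
    apply hT
    unfold descent
    rw [Finset.inl_mem_disjSum]
    exact Finset.mem_erase.mpr ⟨hxp, hx⟩

/-- **Packings of the 2-sum.**  If `A₂` has packing number ≤ 1, then `k` pairwise disjoint witnesses of
the 2-sum inside `X` are the same as `k` pairwise disjoint witnesses of `A₁` inside the left
configuration of `X` (at most one witness can use `p`, because two would give two disjoint witnesses
of `A₂` in the right part). -/
theorem kDisj_twoSum_iff {A₁ : Finset E₁ → Prop} {A₂ : Finset E₂ → Prop} (hA₁ : Incr A₁)
    (hA₂ : Incr A₂) (h₂ : ∀ S, ¬ DOcc A₂ A₂ S) (p : E₁) :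
    ∀ (k : ℕ) (X : Finset (E₁ ⊕ E₂)), kDisj (twoSum A₁ A₂ p) k X ↔ kDisj A₁ k (leftCfg A₂ p X)
  | 0, X => by simp [kDisj]
  | k + 1, X => by
    constructor
    · rintro ⟨K, L, hK, hL, hKL, hAK, hAL⟩
      refine ⟨leftCfg A₂ p K, leftCfg A₂ p L, leftCfg_mono hA₂ p hK, leftCfg_mono hA₂ p hL, ?_, ?_, ?_⟩
      · -- disjoint: the left parts are disjoint, and at most one of them contains `p`
        rw [Finset.disjoint_left]
        intro x hxK hxL
        by_cases hxp : x = p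
        · subst hxp
          have h1 := A₂_of_mem_leftCfg hxK
          have h2 := A₂_of_mem_leftCfg hxL
          apply h₂ (K.toRight ∪ L.toRight)
          refine ⟨K.toRight, L.toRight, Finset.subset_union_left, Finset.subset_union_right, ?_,
            fun T hT => hA₂ hT h1, fun T hT => hA₂ hT h2⟩
          rw [Finset.disjoint_left]
          intro y hyK hyL
          exact Finset.disjoint_left.mp hKL (Finset.mem_toRight.mp hyK) (Finset.mem_toRight.mp hyL)
        · exact Finset.disjoint_left.mp hKL (Finset.mem_toLeft.mp (mem_toLeft_of_mem_leftCfg hxK hxp))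
            (Finset.mem_toLeft.mp (mem_toLeft_of_mem_leftCfg hxL hxp))
      · -- the cylinder over `leftCfg K` lies in `A₁`: lift `T` to the 2-sum
        intro T hT
        have := hAK _ (subset_lift T)
        exact hA₁ (leftCfg_lift_subset hT) this
      · -- the cylinder over `leftCfg L` lies in `kDisj A₁ k`
        intro T hT
        have := (kDisj_twoSum_iff hA₁ hA₂ h₂ p k _).mp (hAL _ (subset_lift T))
        exact incr_kDisj A₁ k (leftCfg_lift_subset hT) this
    · rintro ⟨K', L', hK', hL', hKL', hAK', hAL'⟩
      refine ⟨descent p X K', descent p X L', descent_subset hK', descent_subset hL', ?_, ?_, ?_⟩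
      · -- disjoint descents
        rw [Finset.disjoint_left]
        rintro (x | y) hxK hxL
        · unfold descent at hxK hxL
          rw [Finset.inl_mem_disjSum, Finset.mem_erase] at hxK hxL
          exact Finset.disjoint_left.mp hKL' hxK.2 hxL.2
        · unfold descent at hxK hxL
          rw [Finset.inr_mem_disjSum] at hxK hxL
          by_cases hpK : p ∈ K'
          · by_cases hpL : p ∈ L'
            · exact Finset.disjoint_left.mp hKL' hpK hpL
            · simp [hpL] at hxL
          · simp [hpK] at hxK
      · intro T hT
        exact hAK' _ (subset_leftCfg_of_descent_subset hA₂ hK' hT)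
      · intro T hT
        rw [kDisj_twoSum_iff hA₁ hA₂ h₂ p k]
        exact hAL' _ (subset_leftCfg_of_descent_subset hA₂ hL' hT)

end StepZero

end Summit.Ventures.PercRepro2
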